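import Mathlib
import HarnessLib
import Summits.Ventures.LatticeQCDFlow.Exactness.NCMCGeneralSpaceOverlap

/-!
# Dissipation-only floors on the switch acceptance: Jensen and Bretagnolle–Huber on a general state space

HONEST FRAMING: exact (Metropolis-corrected) sampling algorithms for lattice gauge theory;
figures of merit are autocorrelation/cost numbers at stated couplings and volumes; no
continuum-physics claim.

Venture `LatticeQCDFlow` (cell pub-lqcd), topic `Exactness`; FANOUT row 13 (`eng-snf`, GEN-10).
NEW WORK of the cell (general measure theory, elementary), not a published result; nothing is
cited as a fact (the inequality `TV² ≤ 1 − e^{−KL}` is Bretagnolle–Huber 1979 / Tsybakov's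
Lemma 2.6, named only — it is re-proved here in the cell's variables).  Setting of
`NCMCGeneralSpaceOverlap.lean`: a Crooks pair from `ν₀` to `ν₁`, `P_F`, `P_R`, `e^{−ΔF} = Z₁/Z₀`, the
mean switch acceptance at `c = ΔF`, `acc = E_{P_F}[min(1, e^{−(W−ΔF)})] = 1 − TV(P_F, P_R)`.

WHY.  The engine's planning numbers (`eqscan.metropolized_gaussian`) turn a measured mean
dissipation `⟨W_d⟩` into an acceptance through the Gaussian-work dictionary.  This file gives what
holds for EVERY protocol: floors on `acc` from `⟨W_d⟩` alone.

## Content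

* `exp_neg_integral_posPart_le_accept` — Jensen: `acc ≥ exp(−E_{P_F}[(W − ΔF)⁺])` (forward lane
  alone, integrable work).
* `CrooksPair.integral_max_eq_two_sub_accept` — `E_{P_F}[max(1, e^{−(W−ΔF)})] = 2 − acc`.
* `CrooksPair.sq_integral_exp_half_le` — Cauchy–Schwarz through a discriminant:
  `(E_{P_F}[e^{−(W−ΔF)/2}])² ≤ acc · (2 − acc)` (the Bhattacharyya coefficient of `P_F, P_R` against
  `(1 − TV)(1 + TV)`).
* **`CrooksPair.exp_neg_dissipation_le_accept_mul`** — BRETAGNOLLE–HUBER FOR NON-EQUILIBRIUM SWITCHES: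
  `exp(−(E_{P_F}[W] − ΔF)) ≤ acc · (2 − acc)` for an integrable work, and
  **`CrooksPair.one_sub_sqrt_le_accept`** — `acc ≥ 1 − √(1 − exp(−⟨W_d⟩_F))`;
  `exp_neg_rev_dissipation_le_accept_mul` / `one_sub_sqrt_rev_le_accept` — the same with the REVERSE
  lane's mean dissipation `ΔF − E_{P_R}[W]` (the pair read backwards has the same acceptance).

Nothing is claimed about any VALUE for a concrete protocol; for orientation only (not typed): a
mean dissipation of `0.35` forces `acc ≥ 1 − √(1 − e^{−0.35}) ≈ 0.46` for every work law, against
the Gaussian dictionary's `0.68`.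
-/

namespace Summit.Ventures.LatticeQCDFlow.Exactness.GeneralNCMC

open MeasureTheory ProbabilityTheory Set Filter
open scoped ENNReal

variable {Ω E : Type*} [MeasurableSpace Ω] [MeasurableSpace E]

/-! ## A Jensen lower bound on the acceptance -/

/-- **`acc(ΔF) ≥ exp(−E_{P_F}[(W − ΔF)⁺])`**: the mean acceptance at `c = ΔF` is at least the
exponential of minus the mean POSITIVE PART of the dissipated work (Jensen: `min(1, e^{−x}) =
e^{−x⁺}` and `exp` is convex); in particular `acc(ΔF) ≥ exp(−E_{P_F}|W − ΔF|)`.  Requires an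
integrable work (with Mathlib's conventions the exponent would otherwise read `0`); a property of
the forward lane alone (no Crooks pair needed). -/
theorem exp_neg_integral_posPart_le_accept {ν₀ : Measure Ω} [IsFiniteMeasure ν₀] {κF : Kernel Ω E}
    [IsMarkovKernel κF] (h0 : ν₀ univ ≠ 0) {W : E → ℝ} (ΔF : ℝ)
    (hW : Integrable W (fwdPathLaw ν₀ κF)) :
    Real.exp (-∫ ε, max (W ε - ΔF) 0 ∂(fwdPathLaw ν₀ κF)) ≤
      ∫ ε, min 1 (Real.exp (-(W ε - ΔF))) ∂(fwdPathLaw ν₀ κF) := by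
  haveI := isProbabilityMeasure_fwdPathLaw ν₀ h0 κF
  have hpos : Integrable (fun ε => max (W ε - ΔF) 0) (fwdPathLaw ν₀ κF) :=
    (hW.sub (integrable_const ΔF)).pos_part
  have hf : Integrable (fun ε => -max (W ε - ΔF) 0) (fwdPathLaw ν₀ κF) := hpos.neg
  have hmin : ∀ ε, min 1 (Real.exp (-(W ε - ΔF))) = Real.exp (-max (W ε - ΔF) 0) := fun ε => by
    by_cases hx : W ε - ΔF ≤ 0
    · rw [max_eq_right hx, neg_zero, Real.exp_zero, min_eq_left]
      rw [← Real.exp_zero]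
      exact Real.exp_le_exp.2 (by linarith)
    · rw [max_eq_left (le_of_lt (not_le.1 hx)), min_eq_right]
      rw [← Real.exp_zero]
      exact Real.exp_le_exp.2 (by linarith [not_le.1 hx])
  have hm : AEStronglyMeasurable (fun ε => Real.exp (-max (W ε - ΔF) 0)) (fwdPathLaw ν₀ κF) :=
    (Real.continuous_exp.comp_aestronglyMeasurable hf.aestronglyMeasurable)
  have hgi : Integrable (Real.exp ∘ fun ε => -max (W ε - ΔF) 0) (fwdPathLaw ν₀ κF) := by
    refine (integrable_const (1 : ℝ)).mono' hm (Eventually.of_forall fun ε => ?_)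
    rw [Function.comp_apply, Real.norm_eq_abs, abs_of_pos (Real.exp_pos _), ← Real.exp_zero]
    exact Real.exp_le_exp.2 (neg_nonpos.2 (le_max_right _ _))
  simp_rw [hmin]
  have hj := convexOn_exp.map_integral_le Real.continuous_exp.continuousOn isClosed_univ
    (Eventually.of_forall fun x => mem_univ _) hf hgi
  rw [integral_neg] at hj
  exact hj

namespace CrooksPair

variable {ν₀ ν₁ : Measure Ω} {κF κR : Kernel Ω E} {s e : E → Ω} {W : E → ℝ}

/-! ## Bretagnolle–Huber -/

/-- `E_{P_F}[max(1, e^{−(W−ΔF)})] = 2 − acc` (pointwise `max(1, d) = 1 + d − min(1, d)`, `E[d] = 1`). -/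
theorem integral_max_eq_two_sub_accept [IsFiniteMeasure ν₀] [IsFiniteMeasure ν₁] [IsMarkovKernel κF]
    [IsMarkovKernel κR] (h0 : ν₀ univ ≠ 0) (h : CrooksPair ν₀ ν₁ κF κR s e W) {ΔF : ℝ}
    (hΔF : Real.exp (-ΔF) = ((ν₀ univ)⁻¹ * ν₁ univ).toReal) :
    ∫ ε, max 1 (Real.exp (-(W ε - ΔF))) ∂(fwdPathLaw ν₀ κF) =
      2 - ∫ ε, min 1 (Real.exp (-(W ε - ΔF))) ∂(fwdPathLaw ν₀ κF) := by
  haveI := isProbabilityMeasure_fwdPathLaw ν₀ h0 κF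
  have hform : ∀ ε, Real.exp (-(W ε - ΔF)) = Real.exp (ΔF - W ε) := fun ε => by
    rw [show -(W ε - ΔF) = ΔF - W ε by ring]
  have hdi : Integrable (fun ε => Real.exp (-(W ε - ΔF))) (fwdPathLaw ν₀ κF) := by
    simp_rw [hform]
    exact h.integrable_density h0 ΔF
  have hd1 : ∫ ε, Real.exp (-(W ε - ΔF)) ∂(fwdPathLaw ν₀ κF) = 1 := by
    simp_rw [hform]
    exact h.integral_density_eq_one hΔF
  have hmi := h.integrable_accept h0 ΔF
  have hpt : ∀ ε, max 1 (Real.exp (-(W ε - ΔF))) =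
      1 + Real.exp (-(W ε - ΔF)) - min 1 (Real.exp (-(W ε - ΔF))) := fun ε => by
    rcases le_total 1 (Real.exp (-(W ε - ΔF))) with hle | hle
    · rw [max_eq_right hle, min_eq_left hle]
      ring
    · rw [max_eq_left hle, min_eq_right hle]
      ring
  have hA : Integrable (fun ε => 1 + Real.exp (-(W ε - ΔF))) (fwdPathLaw ν₀ κF) :=
    (integrable_const 1).add hdi
  simp_rw [hpt]
  rw [integral_sub hA hmi, integral_add (integrable_const 1) hdi, integral_const, smul_eq_mul,
    probReal_univ, hd1]
  ring

/-- **Cauchy–Schwarz through a discriminant**: `(E_{P_F}[e^{−(W−ΔF)/2}])² ≤ acc · (2 − acc)`.  With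
`u = e^{−(W−ΔF)/2}`: `min(1,u)·max(1,u) = u`, `min(1,u)² = min(1, e^{−(W−ΔF)})`, `max(1,u)² = max(1,
e^{−(W−ΔF)})`, and `0 ≤ E[(t·min(1,u) − max(1,u))²] = t²·acc − 2t·E[u] + (2 − acc)` for every real
`t`. -/
theorem sq_integral_exp_half_le [IsFiniteMeasure ν₀] [IsFiniteMeasure ν₁] [IsMarkovKernel κF]
    [IsMarkovKernel κR] (h0 : ν₀ univ ≠ 0) (h : CrooksPair ν₀ ν₁ κF κR s e W) {ΔF : ℝ}
    (hΔF : Real.exp (-ΔF) = ((ν₀ univ)⁻¹ * ν₁ univ).toReal) :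
    (∫ ε, Real.exp (-(W ε - ΔF) / 2) ∂(fwdPathLaw ν₀ κF)) ^ 2 ≤
      (∫ ε, min 1 (Real.exp (-(W ε - ΔF))) ∂(fwdPathLaw ν₀ κF)) *
        (2 - ∫ ε, min 1 (Real.exp (-(W ε - ΔF))) ∂(fwdPathLaw ν₀ κF)) := by
  haveI := isProbabilityMeasure_fwdPathLaw ν₀ h0 κF
  set μ := fwdPathLaw ν₀ κF with hμ
  set u : E → ℝ := fun ε => Real.exp (-(W ε - ΔF) / 2) with hu
  have hupos : ∀ ε, 0 < u ε := fun ε => Real.exp_pos _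
  have husq : ∀ ε, u ε ^ 2 = Real.exp (-(W ε - ΔF)) := fun ε => by
    rw [hu, sq, ← Real.exp_add]
    congr 1
    ring
  -- measurability / integrability
  have hWm := h.measurable_W
  have hum : Measurable u := Real.measurable_exp.comp ((hWm.sub measurable_const).neg.div_const 2)
  have hmi : Integrable (fun ε => min 1 (Real.exp (-(W ε - ΔF)))) μ := h.integrable_accept h0 ΔF
  have hform : ∀ ε, Real.exp (-(W ε - ΔF)) = Real.exp (ΔF - W ε) := fun ε => by
    rw [show -(W ε - ΔF) = ΔF - W ε by ring]
  have hdi : Integrable (fun ε => Real.exp (-(W ε - ΔF))) μ := by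
    simp_rw [hform]
    exact h.integrable_density h0 ΔF
  have hB : Integrable (fun ε => 1 + Real.exp (-(W ε - ΔF))) μ := (integrable_const 1).add hdi
  have hmaxi : Integrable (fun ε => max 1 (Real.exp (-(W ε - ΔF)))) μ := by
    refine hB.mono'
      ((measurable_const.max (Real.measurable_exp.comp (hWm.sub measurable_const).neg)).aestronglyMeasurable)
      (Eventually.of_forall fun ε => ?_)
    rw [Real.norm_eq_abs, abs_of_pos (lt_max_of_lt_left one_pos)]
    exact max_le (by linarith [Real.exp_pos (-(W ε - ΔF))]) (by linarith)
  have hui : Integrable u μ := by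
    refine hB.mono' hum.aestronglyMeasurable (Eventually.of_forall fun ε => ?_)
    rw [Real.norm_eq_abs, abs_of_pos (hupos ε), ← husq]
    nlinarith [hupos ε, sq_nonneg (u ε - 1)]
  -- pointwise identities for `min(1,u)`, `max(1,u)`
  have hmin_sq : ∀ ε, min 1 (u ε) ^ 2 = min 1 (Real.exp (-(W ε - ΔF))) := fun ε => by
    rw [← husq]
    rcases le_total 1 (u ε) with hle | hle
    · rw [min_eq_left hle, min_eq_left (by nlinarith), one_pow]
    · rw [min_eq_right hle, min_eq_right (by nlinarith [hupos ε])]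
  have hmax_sq : ∀ ε, max 1 (u ε) ^ 2 = max 1 (Real.exp (-(W ε - ΔF))) := fun ε => by
    rw [← husq]
    rcases le_total 1 (u ε) with hle | hle
    · rw [max_eq_right hle, max_eq_right (by nlinarith)]
    · rw [max_eq_left hle, max_eq_left (by nlinarith [hupos ε]), one_pow]
  have hminmax : ∀ ε, min 1 (u ε) * max 1 (u ε) = u ε := fun ε => by
    rcases le_total 1 (u ε) with hle | hle
    · rw [min_eq_left hle, max_eq_right hle, one_mul]
    · rw [min_eq_right hle, max_eq_left hle, mul_one]
  -- the quadratic in `t`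
  set a := ∫ ε, min 1 (Real.exp (-(W ε - ΔF))) ∂μ with ha
  set b := ∫ ε, u ε ∂μ with hb
  have hquad : ∀ t : ℝ, 0 ≤ a * (t * t) + (-2 * b) * t + (2 - a) := by
    intro t
    have hexp : ∀ ε, (t * min 1 (u ε) - max 1 (u ε)) ^ 2 =
        t ^ 2 * min 1 (Real.exp (-(W ε - ΔF))) - 2 * t * u ε + max 1 (Real.exp (-(W ε - ΔF))) :=
      fun ε => by
        have hsq' : (t * min 1 (u ε) - max 1 (u ε)) ^ 2 =
            t ^ 2 * min 1 (u ε) ^ 2 - 2 * t * (min 1 (u ε) * max 1 (u ε)) + max 1 (u ε) ^ 2 := by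
          ring
        rw [hsq', hminmax ε, hmin_sq ε, hmax_sq ε]
    have hI1 : Integrable (fun ε => t ^ 2 * min 1 (Real.exp (-(W ε - ΔF)))) μ := hmi.const_mul _
    have hI2 : Integrable (fun ε => 2 * t * u ε) μ := hui.const_mul _
    have hI12 : Integrable (fun ε => t ^ 2 * min 1 (Real.exp (-(W ε - ΔF))) - 2 * t * u ε) μ :=
      hI1.sub hI2
    have hnn : 0 ≤ ∫ ε, (t * min 1 (u ε) - max 1 (u ε)) ^ 2 ∂μ :=
      integral_nonneg fun ε => sq_nonneg _
    simp_rw [hexp] at hnn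
    rw [integral_add hI12 hmaxi, integral_sub hI1 hI2, integral_const_mul, integral_const_mul,
      h.integral_max_eq_two_sub_accept h0 hΔF] at hnn
    rw [← ha] at hnn
    nlinarith [hnn]
  have hdisc := discrim_le_zero hquad
  rw [discrim] at hdisc
  nlinarith [hdisc]

/-- **Bretagnolle–Huber for non-equilibrium switches, forward lane**: for an integrable work,
`exp(−(E_{P_F}[W] − ΔF)) ≤ acc · (2 − acc)` (Jensen `e^{−⟨W_d⟩/2} ≤ E[e^{−W_d/2}]`, then
`sq_integral_exp_half_le`). -/
theorem exp_neg_dissipation_le_accept_mul [IsFiniteMeasure ν₀] [IsFiniteMeasure ν₁]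
    [IsMarkovKernel κF] [IsMarkovKernel κR] (h0 : ν₀ univ ≠ 0) (h : CrooksPair ν₀ ν₁ κF κR s e W)
    {ΔF : ℝ} (hΔF : Real.exp (-ΔF) = ((ν₀ univ)⁻¹ * ν₁ univ).toReal)
    (hW : Integrable W (fwdPathLaw ν₀ κF)) :
    Real.exp (-(∫ ε, W ε ∂(fwdPathLaw ν₀ κF) - ΔF)) ≤
      (∫ ε, min 1 (Real.exp (-(W ε - ΔF))) ∂(fwdPathLaw ν₀ κF)) *
        (2 - ∫ ε, min 1 (Real.exp (-(W ε - ΔF))) ∂(fwdPathLaw ν₀ κF)) := by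
  haveI := isProbabilityMeasure_fwdPathLaw ν₀ h0 κF
  have hf : Integrable (fun ε => -(W ε - ΔF) / 2) (fwdPathLaw ν₀ κF) :=
    (hW.sub (integrable_const ΔF)).neg.div_const 2
  -- `e^{f}` is integrable: bounded by `1 + e^{−(W−ΔF)}`
  have hform : ∀ ε, Real.exp (-(W ε - ΔF)) = Real.exp (ΔF - W ε) := fun ε => by
    rw [show -(W ε - ΔF) = ΔF - W ε by ring]
  have hdi : Integrable (fun ε => Real.exp (-(W ε - ΔF))) (fwdPathLaw ν₀ κF) := by
    simp_rw [hform]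
    exact h.integrable_density h0 ΔF
  have husq : ∀ ε, Real.exp (-(W ε - ΔF) / 2) ^ 2 = Real.exp (-(W ε - ΔF)) := fun ε => by
    rw [sq, ← Real.exp_add]
    congr 1
    ring
  have hB : Integrable (fun ε => 1 + Real.exp (-(W ε - ΔF))) (fwdPathLaw ν₀ κF) :=
    (integrable_const 1).add hdi
  have hgi : Integrable (Real.exp ∘ fun ε => -(W ε - ΔF) / 2) (fwdPathLaw ν₀ κF) := by
    refine hB.mono' (Real.continuous_exp.comp_aestronglyMeasurable hf.aestronglyMeasurable)
      (Eventually.of_forall fun ε => ?_)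
    rw [Function.comp_apply, Real.norm_eq_abs, abs_of_pos (Real.exp_pos _), ← husq]
    nlinarith [Real.exp_pos (-(W ε - ΔF) / 2), sq_nonneg (Real.exp (-(W ε - ΔF) / 2) - 1)]
  have hj := convexOn_exp.map_integral_le Real.continuous_exp.continuousOn isClosed_univ
    (Eventually.of_forall fun x => mem_univ _) hf hgi
  -- `∫ f = −(E[W] − ΔF)/2`
  have hintf : ∫ ε, -(W ε - ΔF) / 2 ∂(fwdPathLaw ν₀ κF) = -(∫ ε, W ε ∂(fwdPathLaw ν₀ κF) - ΔF) / 2 := by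
    have h1 : ∫ ε, -(W ε - ΔF) / 2 ∂(fwdPathLaw ν₀ κF) =
        ∫ ε, (-1 / 2) * (W ε - ΔF) ∂(fwdPathLaw ν₀ κF) := integral_congr_ae (Eventually.of_forall
          fun ε => by simp only; ring)
    rw [h1, integral_const_mul, integral_sub hW (integrable_const ΔF), integral_const, smul_eq_mul,
      probReal_univ, one_mul]
    ring
  rw [hintf] at hj
  have hsq := h.sq_integral_exp_half_le h0 hΔF
  have hpos : 0 < Real.exp (-(∫ ε, W ε ∂(fwdPathLaw ν₀ κF) - ΔF) / 2) := Real.exp_pos _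
  calc Real.exp (-(∫ ε, W ε ∂(fwdPathLaw ν₀ κF) - ΔF))
      = Real.exp (-(∫ ε, W ε ∂(fwdPathLaw ν₀ κF) - ΔF) / 2) ^ 2 := by
        rw [sq, ← Real.exp_add]
        congr 1
        ring
    _ ≤ (∫ ε, Real.exp (-(W ε - ΔF) / 2) ∂(fwdPathLaw ν₀ κF)) ^ 2 :=
        pow_le_pow_left₀ hpos.le hj 2
    _ ≤ _ := hsq

/-- **`acc ≥ 1 − √(1 − exp(−⟨W_d⟩_F))`** — the dissipation-only floor on the switch acceptance, for
every protocol certified as a Crooks pair with integrable work. -/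
theorem one_sub_sqrt_le_accept [IsFiniteMeasure ν₀] [IsFiniteMeasure ν₁]
    [IsMarkovKernel κF] [IsMarkovKernel κR] (h0 : ν₀ univ ≠ 0) (h : CrooksPair ν₀ ν₁ κF κR s e W)
    {ΔF : ℝ} (hΔF : Real.exp (-ΔF) = ((ν₀ univ)⁻¹ * ν₁ univ).toReal)
    (hW : Integrable W (fwdPathLaw ν₀ κF)) :
    1 - Real.sqrt (1 - Real.exp (-(∫ ε, W ε ∂(fwdPathLaw ν₀ κF) - ΔF))) ≤
      ∫ ε, min 1 (Real.exp (-(W ε - ΔF))) ∂(fwdPathLaw ν₀ κF) := by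
  have hbh := h.exp_neg_dissipation_le_accept_mul h0 hΔF hW
  set a := ∫ ε, min 1 (Real.exp (-(W ε - ΔF))) ∂(fwdPathLaw ν₀ κF)
  have hsq : (1 - a) ^ 2 ≤ 1 - Real.exp (-(∫ ε, W ε ∂(fwdPathLaw ν₀ κF) - ΔF)) := by nlinarith [hbh]
  have := Real.le_sqrt_of_sq_le hsq
  linarith

/-- **Bretagnolle–Huber, reverse lane**: for a `P_R`-integrable work,
`exp(−(ΔF − E_{P_R}[W])) ≤ acc · (2 − acc)` (the pair read backwards has the same acceptance,
`NCMCGeneralSpaceOverlap.integral_accept_rev_eq`). -/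
theorem exp_neg_rev_dissipation_le_accept_mul [IsFiniteMeasure ν₀] [IsFiniteMeasure ν₁]
    [IsMarkovKernel κF] [IsMarkovKernel κR] (h0 : ν₀ univ ≠ 0) (h1 : ν₁ univ ≠ 0)
    (h : CrooksPair ν₀ ν₁ κF κR s e W) {ΔF : ℝ}
    (hΔF : Real.exp (-ΔF) = ((ν₀ univ)⁻¹ * ν₁ univ).toReal)
    (hW : Integrable W (fwdPathLaw ν₁ κR)) :
    Real.exp (-(ΔF - ∫ ε, W ε ∂(fwdPathLaw ν₁ κR))) ≤
      (∫ ε, min 1 (Real.exp (-(W ε - ΔF))) ∂(fwdPathLaw ν₀ κF)) *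
        (2 - ∫ ε, min 1 (Real.exp (-(W ε - ΔF))) ∂(fwdPathLaw ν₀ κF)) := by
  have hs := h.symm.exp_neg_dissipation_le_accept_mul h1 (exp_freeEnergyDiff h0 h1 hΔF) hW.neg
  have hacc : ∫ ε, min 1 (Real.exp (-(-W ε - -ΔF))) ∂(fwdPathLaw ν₁ κR) =
      ∫ ε, min 1 (Real.exp (-(W ε - ΔF))) ∂(fwdPathLaw ν₀ κF) := by
    rw [← h.integral_accept_rev_eq h0 h1 hΔF]
    refine integral_congr_ae (Eventually.of_forall fun ε => ?_)
    simp only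
    rw [show -(-W ε - -ΔF) = W ε - ΔF by ring]
  rw [hacc, integral_neg] at hs
  have hexp : -(-∫ ε, W ε ∂(fwdPathLaw ν₁ κR) - -ΔF) = -(ΔF - ∫ ε, W ε ∂(fwdPathLaw ν₁ κR)) := by ring
  rw [hexp] at hs
  exact hs

/-- **`acc ≥ 1 − √(1 − exp(−⟨W_d⟩_R))`** with the reverse lane's mean dissipation. -/
theorem one_sub_sqrt_rev_le_accept [IsFiniteMeasure ν₀] [IsFiniteMeasure ν₁]
    [IsMarkovKernel κF] [IsMarkovKernel κR] (h0 : ν₀ univ ≠ 0) (h1 : ν₁ univ ≠ 0)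
    (h : CrooksPair ν₀ ν₁ κF κR s e W) {ΔF : ℝ}
    (hΔF : Real.exp (-ΔF) = ((ν₀ univ)⁻¹ * ν₁ univ).toReal)
    (hW : Integrable W (fwdPathLaw ν₁ κR)) :
    1 - Real.sqrt (1 - Real.exp (-(ΔF - ∫ ε, W ε ∂(fwdPathLaw ν₁ κR)))) ≤
      ∫ ε, min 1 (Real.exp (-(W ε - ΔF))) ∂(fwdPathLaw ν₀ κF) := by
  have hbh := h.exp_neg_rev_dissipation_le_accept_mul h0 h1 hΔF hW
  set a := ∫ ε, min 1 (Real.exp (-(W ε - ΔF))) ∂(fwdPathLaw ν₀ κF)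
  have hsq : (1 - a) ^ 2 ≤ 1 - Real.exp (-(ΔF - ∫ ε, W ε ∂(fwdPathLaw ν₁ κR))) := by nlinarith [hbh]
  have := Real.le_sqrt_of_sq_le hsq
  linarith

end CrooksPair

end Summit.Ventures.LatticeQCDFlow.Exactness.GeneralNCMC
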